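import Literature.NumberTheory.Automorphic.Liu2021.AppendixC.BettiPinningHeckeEndomorphism
import Literature.NumberTheory.Automorphic.HeckeFixedVectorsMultiplicityFree
import Literature.NumberTheory.Automorphic.HeckeFixedVectorsLift
import Literature.AlgebraicGeometry.HodgeTheory.CMTypeIffCentralizerCommutative
import HarnessLib

/-!
# [Liu 2021, Cor. 4.20 («the Albanese is of CM type») ⇐ Prop. 4.13 read through Hecke correspondences] the Albanese `A_K ×_{τ'} ℂ` of a
# pinned Betti tower with a MULTIPLICITY-FREE theta decomposition is of CM-type — the generic lever of LINE T5′ (cell hodgecm-mathlib)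

Topic `NumberTheory/Automorphic/Liu2021/AppendixC`; namespace `Literature.NumberTheory.Automorphic.Liu2021.AppendixC`.  THEOREMS ONLY
(no definition, no named fact, no instance, no `sorry`).  Assembles, generically over a §4.2 datum `C`, Albanese Hecke translates
`T` with descent up to isogeny (`hD : T.IsogenyDescent`, row (D)), an embedding `τ'` and a pinned Betti tower `(H, rhoB, B)`:

* `BettiPinningLevelDescent` (`range b_K = H^K`) and `BettiPinningHeckeEndomorphism` (`b_K ∘ ψ_g^* = m_g • [KgK] ∘ b_K` for an HONEST
  `ψ_g ∈ End(A_K)`, `m_g ≠ 0`);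
* the tree's «multiplicity one ⇒ commutative Hecke commutant» `HeckeFixedVectorsMultiplicityFree.commute_of_forall_commute_heckeOperator_of_directSum`
  (over `HeckeFixedVectorsSimple`, `HeckeFixedVectorsLift`, `RingTheory/SimpleModule/MultiplicityFreeCommutant`);
* Milne's lever `HodgeTheory.isOfCMType_of_forall_commute_pullbackOne_comm` (`CMTypeIffCentralizerCommutative`: a family `R ⊆ End A`
  whose pull-backs have a commutative commutant on `H¹(A(ℂ); ℂ)` forces CM-type — Deligne I §5, Milne 1999 Rem. 1.10).

into **`Sec42Data.BettiPinning.isOfCMType_baseChange_of_directSum`**: if `(H, rhoB)` decomposes `𝔾(𝔸_F^∞)`-equivariantly as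
`Ψ : H ≃ ⊕_t W_t` with irreducible, pairwise Hecke-disjoint summands (Schur's form: for `s ≠ t` every Hecke-equivariant linear map
`W_s^K → W_t^K` vanishes — for non-isomorphic irreducibles this is `HeckeFixedVectorsLift.eq_zero_of_heckeEquivariant_of_isEmpty_equiv`),
then for EVERY small level `K` the complex abelian variety `A_K ×_{E,τ'} ℂ` is of CM-type (`Milne1999.IsOfCMType`, for the `E`-algebra
structure `algebraAlong τ'` on `ℂ`).  Print: [Liu2021] Prop. 4.13 + «the `ℂ[𝔾(𝔸_F^∞)]`-modules in the direct sum are mutually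
non-isomorphic» (Thm. 4.18 (2)) ⇒ Cor. 4.20 / Thm. 1.1 (the Albanese is CM) — print passes through the `ℓ`-adic comparison and Faltings'
isogeny theorem; this file passes through the Mumford–Tate torus (Murty–Ramakrishnan 1992 §2's route), with NO input beyond the
decomposition.  At the face of the cell's line a3-liu418 the decomposition is [Prop. 4.13] = the binder `H413` (`BettiThetaDecomposition`),
irreducibility is [Def. 4.11] (`H411`, closed) and disjointness is ★ `admTripleAll_UV_eq_of_equiv`; see the Summits-side file
`CorCM/HypLiu418/A3Liu418T5pAlbaneseCMType`.

HC_CM is proved only modulo the 7 printed citations until rung 0 closes; this file is unconditional and discharges none of them.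

## References
* [Liu2021] Y. Liu, Camb. J. Math. 9 (2021) = arXiv:2102.11518: Prop. 4.13 (FJcycle.tex l. 2110–2131); Thm. 4.18 (1)–(2) (l. 2232–2245)
  with proof (l. 2247–2282); §4.2 (l. 2070–2081); Def. 4.19 / Cor. 4.20 (print p. 54).
* [MurtyRamakrishnan1992] V. K. Murty, D. Ramakrishnan, *The Albanese of unitary Shimura varieties*, CRM Proc. (1992), §2 Prop. 2 (p. 452) —
  the shape of the argument (Hecke correspondences as endomorphisms of `Alb`, multiplicity one); nothing of it is cited as a fact.
* [Milne1999] J. S. Milne, *Lefschetz motives and the Tate conjecture*, Compositio Math. 117 (1999), §1 Remark 1.10 (p. 53).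
* [Deligne1982HodgeCycles] P. Deligne, *Hodge cycles on abelian varieties*, LNM 900 (1982), I §5 Prop. 5.1 (proof).
-/

noncomputable section

open CategoryTheory NumberField Function MulAction
open scoped TensorProduct DirectSum

namespace Literature.NumberTheory.Automorphic.Liu2021.AppendixC

open Literature.AlgebraicGeometry.Motives (AbelianVariety)
open Literature.AlgebraicGeometry.HodgeTheory (complexBetti finite_complexBetti_abelianVariety isOfCMType_of_forall_commute_pullbackOne_comm)
open Literature.AlgebraicGeometry.VanGeemen1994 (pullbackOne)
open Literature.AlgebraicGeometry.Milne1999 (IsOfCMType)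

variable {F E : Type} [Field F] [NumberField F] [IsTotallyReal F] [Field E] [NumberField E] [Algebra F E]
  [IsTotallyComplex E] [Algebra.IsQuadraticExtension F E]
variable {P5 : PropC5Data F E} {isotropicAt : ℕ → Prop}

namespace Sec42Data.BettiPinning

variable {C : Sec42Data P5 isotropicAt} {T : C.HeckeTranslates} {τ' : E →+* ℂ} {H : Type} [AddCommGroup H] [Module ℂ H]
  {rhoB : Representation ℂ C.G H}

/-- `ψ^*` on `H¹_{B,τ'}(A_K, ℂ)` IS the pull-back `pullbackOne (A_K ×_{τ'} ℂ) (ψ ×_{τ'} ℂ)` of the tree's Hodge-theory files (both are the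
singular-cohomology map of `(ψ ×_{τ'} ℂ)(ℂ)`; `rfl`). [cite: Liu2021, §4.2 l. 2070–2079] -/
theorem pullbackOne_baseChange_eq_bettiPullAlong (τ' : E →+* ℂ) {K : C5.SmallLevel C.S.K₀} (ψ : C.A K ⟶ C.A K) :
    letI : Algebra E ℂ := algebraAlong E τ'
    pullbackOne ((C.A K).baseChange ℂ) (AbelianVariety.Hom.baseChange ℂ ψ) = bettiPullAlong τ' ψ :=
  rfl

/-- **The Albanese `A_K ×_{τ'} ℂ` of a pinned Betti tower with a multiplicity-free equivariant decomposition is of CM-type.**  Data: a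
§4.2 datum `C`, translates `T` with `T.IsogenyDescent` (row (D)), a Betti pinning `B` of `(H, rhoB)` along `τ'`, and a `𝔾(𝔸_F^∞)`-equivariant
decomposition `Ψ : H ≃ ⊕_t W_t` into IRREDUCIBLE summands whose `K`-fixed vectors are pairwise Hecke-disjoint (`hdisj`, Schur's form).
Then `A_K ×_{E,τ'} ℂ` is of CM-type.  Proof: by `BettiPinningHeckeEndomorphism` every Hecke operator `[KgK]` on `H^K = b_K(H¹_{B,τ'}(A_K, ℂ))`
(`BettiPinningLevelDescent.range_b_eq_fixedPoints`) is `m_g⁻¹ ψ_g^*` for an honest `ψ_g ∈ End(A_K)`; two endomorphisms of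
`H¹((A_K ×_{τ'} ℂ)(ℂ); ℂ)` commuting with all `ψ_g^*` commute with the `[KgK]` read on level `K`, hence with each other by multiplicity one
(`commute_of_forall_commute_heckeOperator_of_directSum`); so the commutant of `{(ψ_g ×_{τ'} ℂ)^*}` is commutative and Milne's lever
`isOfCMType_of_forall_commute_pullbackOne_comm` gives CM-type.  [Liu2021] reaches the same conclusion (Cor. 4.20) through `ℓ`-adic
comparison + Faltings; this is the Mumford–Tate road. [cite: Liu2021, Prop. 4.13 (FJcycle.tex l. 2110–2131); Thm. 4.18 (2) (l. 2241) and (1) proof (l. 2274–2282); Cor. 4.20 (print p. 54)]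
[cite: Milne1999, §1 Remark 1.10 (p. 53)] [cite: Deligne1982HodgeCycles, I §5 Prop. 5.1 (proof)] -/
theorem isOfCMType_baseChange_of_directSum (B : C.BettiPinning T τ' H rhoB) (hD : T.IsogenyDescent)
    {ι : Type} {W : ι → Type} [∀ t, AddCommGroup (W t)] [∀ t, Module ℂ (W t)]
    (σ : ∀ t, Representation ℂ C.G (W t)) [∀ t, (σ t).IsIrreducible]
    (Ψ : H ≃ₗ[ℂ] ⨁ t, W t) (hΨ : ∀ (g : C.G) (v : H) (t : ι), Ψ (rhoB g v) t = σ t g (Ψ v t))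
    (K : C5.SmallLevel C.S.K₀)
    (hdisj : ∀ s t, s ≠ t → ∀ φ : W s →ₗ[ℂ] W t,
      (∀ w ∈ (σ s).fixedPoints (K.1.1 : Subgroup C.G), φ w ∈ (σ t).fixedPoints (K.1.1 : Subgroup C.G)) →
      (∀ g : C.G, ∀ w ∈ (σ s).fixedPoints (K.1.1 : Subgroup C.G),
        φ (Literature.NumberTheory.Automorphic.heckeOperator (σ s) K.1.1 g w) =
          Literature.NumberTheory.Automorphic.heckeOperator (σ t) K.1.1 g (φ w)) →
        ∀ w ∈ (σ s).fixedPoints (K.1.1 : Subgroup C.G), φ w = 0) :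
    letI : Algebra E ℂ := algebraAlong E τ'
    IsOfCMType ((C.A K).baseChange ℂ) := by
  letI : Algebra E ℂ := algebraAlong E τ'
  classical
  -- the Hecke operators at level `K` as honest endomorphisms `ψ_g` of `A_K`, up to `m_g ≠ 0`
  choose m ψ hm hψ using fun g : C.G => B.exists_hom_b_bettiPullAlong_eq_smul_heckeOperator hD K g
  haveI : FiniteDimensional ℂ (C.bettiH1 τ' K) := finite_complexBetti_abelianVariety _ 1
  -- the level-`K` model `(E, b, T) := (H¹_{B,τ'}(A_K, ℂ), b_K, m_g⁻¹ ψ_g^*)` of `H^K`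
  have hT : ∀ (g : C.G) (e : C.bettiH1 τ' K),
      B.b K ((((m g : ℂ))⁻¹ • bettiPullAlong τ' (ψ g)) e) =
        Literature.NumberTheory.Automorphic.heckeOperator rhoB (K.1.1 : Subgroup C.G) g (B.b K e) := by
    intro g e
    have hm' : (m g : ℂ) ≠ 0 := Int.cast_ne_zero.2 (hm g)
    rw [LinearMap.smul_apply, map_smul, hψ g e, smul_smul, inv_mul_cancel₀ hm', one_smul]
  -- Milne's lever with `R := {ψ_g ×_{τ'} ℂ}`
  refine isOfCMType_of_forall_commute_pullbackOne_comm
    (Set.range fun g : C.G => AbelianVariety.Hom.baseChange ℂ (ψ g)) fun x y hx hy => ?_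
  have hx' : ∀ g : C.G, x * (((m g : ℂ))⁻¹ • bettiPullAlong τ' (ψ g)) = (((m g : ℂ))⁻¹ • bettiPullAlong τ' (ψ g)) * x := by
    intro g
    rw [mul_smul_comm, smul_mul_assoc, ← pullbackOne_baseChange_eq_bettiPullAlong τ', (hx _ ⟨g, rfl⟩).symm]
  have hy' : ∀ g : C.G, y * (((m g : ℂ))⁻¹ • bettiPullAlong τ' (ψ g)) = (((m g : ℂ))⁻¹ • bettiPullAlong τ' (ψ g)) * y := by
    intro g
    rw [mul_smul_comm, smul_mul_assoc, ← pullbackOne_baseChange_eq_bettiPullAlong τ', (hy _ ⟨g, rfl⟩).symm]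
  exact Literature.NumberTheory.Automorphic.commute_of_forall_commute_heckeOperator_of_directSum (K.1.1 : Subgroup C.G)
    (finite_orbit_level K) rhoB σ Ψ hΨ hdisj (B.b K) (B.b_injective K) (B.range_b_eq_fixedPoints hD K)
    (fun g => ((m g : ℂ))⁻¹ • bettiPullAlong τ' (ψ g)) hT hx' hy'

/-- **The same with non-isomorphy of the summands in place of Hecke-disjointness** (Schur): if the irreducible summands `σ_s`, `σ_t`
(`s ≠ t`) are never isomorphic, their `K`-fixed vectors are Hecke-disjoint by the tree's lifting theorem
`HeckeFixedVectorsLift.eq_zero_of_heckeEquivariant_of_isEmpty_equiv` ([Bump1997] remark after Prop. 4.2.7), so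
`isOfCMType_baseChange_of_directSum` applies. [cite: Liu2021, Thm. 4.18 (2) (FJcycle.tex l. 2241) and Cor. 4.20 (print p. 54)] [cite: Milne1999, §1 Remark 1.10 (p. 53)] -/
theorem isOfCMType_baseChange_of_directSum_of_isEmpty_equiv (B : C.BettiPinning T τ' H rhoB) (hD : T.IsogenyDescent)
    {ι : Type} {W : ι → Type} [∀ t, AddCommGroup (W t)] [∀ t, Module ℂ (W t)]
    (σ : ∀ t, Representation ℂ C.G (W t)) [∀ t, (σ t).IsIrreducible]
    (Ψ : H ≃ₗ[ℂ] ⨁ t, W t) (hΨ : ∀ (g : C.G) (v : H) (t : ι), Ψ (rhoB g v) t = σ t g (Ψ v t))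
    (hne : ∀ s t, s ≠ t → IsEmpty ((σ s).Equiv (σ t))) (K : C5.SmallLevel C.S.K₀) :
    letI : Algebra E ℂ := algebraAlong E τ'
    IsOfCMType ((C.A K).baseChange ℂ) :=
  B.isOfCMType_baseChange_of_directSum hD σ Ψ hΨ K fun s t hst φ hφK hφ =>
    Literature.NumberTheory.Automorphic.eq_zero_of_heckeEquivariant_of_isEmpty_equiv (σ s) (σ t) K.1.1
      (finite_orbit_level K) (hne s t hst) φ hφK hφ

/-! ## §2 Irreducible-OR-ZERO summands, and the separation form of disjointness -/

/-- **The same lever with irreducible-or-zero summands** (the reading of «irreducible» in [Liu2021, Def. 4.11 / Lem. D.1], where a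
summand may vanish): `hirr t : ∀ U : Subrepresentation (σ t), U = ⊥ ∨ U = ⊤` in place of `(σ t).IsIrreducible`; zero summands drop out
(`commute_of_forall_commute_heckeOperator_of_directSum_of_isIrreducibleOrZero`). [cite: Liu2021, Def. 4.11 (FJcycle.tex l. 2096), Prop. 4.13 (l. 2110–2131), Cor. 4.20 (print p. 54)]
[cite: Milne1999, §1 Remark 1.10 (p. 53)] -/
theorem isOfCMType_baseChange_of_directSum_of_isIrreducibleOrZero (B : C.BettiPinning T τ' H rhoB) (hD : T.IsogenyDescent)
    {ι : Type} {W : ι → Type} [∀ t, AddCommGroup (W t)] [∀ t, Module ℂ (W t)]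
    (σ : ∀ t, Representation ℂ C.G (W t)) (hirr : ∀ t, ∀ U : Subrepresentation (σ t), U = ⊥ ∨ U = ⊤)
    (Ψ : H ≃ₗ[ℂ] ⨁ t, W t) (hΨ : ∀ (g : C.G) (v : H) (t : ι), Ψ (rhoB g v) t = σ t g (Ψ v t))
    (K : C5.SmallLevel C.S.K₀)
    (hdisj : ∀ s t, s ≠ t → ∀ φ : W s →ₗ[ℂ] W t,
      (∀ w ∈ (σ s).fixedPoints (K.1.1 : Subgroup C.G), φ w ∈ (σ t).fixedPoints (K.1.1 : Subgroup C.G)) →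
      (∀ g : C.G, ∀ w ∈ (σ s).fixedPoints (K.1.1 : Subgroup C.G),
        φ (Literature.NumberTheory.Automorphic.heckeOperator (σ s) K.1.1 g w) =
          Literature.NumberTheory.Automorphic.heckeOperator (σ t) K.1.1 g (φ w)) →
        ∀ w ∈ (σ s).fixedPoints (K.1.1 : Subgroup C.G), φ w = 0) :
    letI : Algebra E ℂ := algebraAlong E τ'
    IsOfCMType ((C.A K).baseChange ℂ) := by
  letI : Algebra E ℂ := algebraAlong E τ'
  classical
  choose m ψ hm hψ using fun g : C.G => B.exists_hom_b_bettiPullAlong_eq_smul_heckeOperator hD K g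
  haveI : FiniteDimensional ℂ (C.bettiH1 τ' K) := finite_complexBetti_abelianVariety _ 1
  have hT : ∀ (g : C.G) (e : C.bettiH1 τ' K),
      B.b K ((((m g : ℂ))⁻¹ • bettiPullAlong τ' (ψ g)) e) =
        Literature.NumberTheory.Automorphic.heckeOperator rhoB (K.1.1 : Subgroup C.G) g (B.b K e) := by
    intro g e
    have hm' : (m g : ℂ) ≠ 0 := Int.cast_ne_zero.2 (hm g)
    rw [LinearMap.smul_apply, map_smul, hψ g e, smul_smul, inv_mul_cancel₀ hm', one_smul]
  refine isOfCMType_of_forall_commute_pullbackOne_comm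
    (Set.range fun g : C.G => AbelianVariety.Hom.baseChange ℂ (ψ g)) fun x y hx hy => ?_
  have hx' : ∀ g : C.G, x * (((m g : ℂ))⁻¹ • bettiPullAlong τ' (ψ g)) = (((m g : ℂ))⁻¹ • bettiPullAlong τ' (ψ g)) * x := by
    intro g
    rw [mul_smul_comm, smul_mul_assoc, ← pullbackOne_baseChange_eq_bettiPullAlong τ', (hx _ ⟨g, rfl⟩).symm]
  have hy' : ∀ g : C.G, y * (((m g : ℂ))⁻¹ • bettiPullAlong τ' (ψ g)) = (((m g : ℂ))⁻¹ • bettiPullAlong τ' (ψ g)) * y := by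
    intro g
    rw [mul_smul_comm, smul_mul_assoc, ← pullbackOne_baseChange_eq_bettiPullAlong τ', (hy _ ⟨g, rfl⟩).symm]
  exact Literature.NumberTheory.Automorphic.commute_of_forall_commute_heckeOperator_of_directSum_of_isIrreducibleOrZero
    (K.1.1 : Subgroup C.G) (finite_orbit_level K) rhoB σ hirr Ψ hΨ hdisj (B.b K) (B.b_injective K)
    (B.range_b_eq_fixedPoints hD K) (fun g => ((m g : ℂ))⁻¹ • bettiPullAlong τ' (ψ g)) hT hx' hy'

/-- **The separation form** — the shape in which the cell's line a3-liu418 holds non-isomorphy of the theta summands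
(`admTripleAll_UV_eq_of_equiv`: a NON-ZERO summand equivariantly isomorphic to another has the same label): with irreducible-or-zero
summands and `hsep`, the `K`-fixed vectors of distinct summands are Hecke-disjoint (zero summands trivially; two non-zero ones are
irreducible and non-isomorphic, so `HeckeFixedVectorsLift.eq_zero_of_heckeEquivariant_of_isEmpty_equiv` applies), and
`isOfCMType_baseChange_of_directSum_of_isIrreducibleOrZero` gives CM-type of `A_K ×_{τ'} ℂ` at every small level.
[cite: Liu2021, Thm. 4.18 (2) (FJcycle.tex l. 2241), Prop. 4.13 (l. 2110–2131), Cor. 4.20 (print p. 54)] [cite: Milne1999, §1 Remark 1.10 (p. 53)] -/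
theorem isOfCMType_baseChange_of_directSum_of_eq_of_equiv (B : C.BettiPinning T τ' H rhoB) (hD : T.IsogenyDescent)
    {ι : Type} {W : ι → Type} [∀ t, AddCommGroup (W t)] [∀ t, Module ℂ (W t)]
    (σ : ∀ t, Representation ℂ C.G (W t)) (hirr : ∀ t, ∀ U : Subrepresentation (σ t), U = ⊥ ∨ U = ⊤)
    (Ψ : H ≃ₗ[ℂ] ⨁ t, W t) (hΨ : ∀ (g : C.G) (v : H) (t : ι), Ψ (rhoB g v) t = σ t g (Ψ v t))
    (hsep : ∀ s t, Nontrivial (W s) →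
      (∃ f : W s ≃ₗ[ℂ] W t, ∀ (g : C.G) (v : W s), f (σ s g v) = σ t g (f v)) → s = t)
    (K : C5.SmallLevel C.S.K₀) :
    letI : Algebra E ℂ := algebraAlong E τ'
    IsOfCMType ((C.A K).baseChange ℂ) := by
  refine B.isOfCMType_baseChange_of_directSum_of_isIrreducibleOrZero hD σ hirr Ψ hΨ K fun s t hst φ hφK hφ w hw => ?_
  -- zero summands: nothing to prove
  by_cases hs : Nontrivial (W s)
  swap
  · haveI : Subsingleton (W s) := not_nontrivial_iff_subsingleton.1 hs
    rw [Subsingleton.elim w 0, map_zero]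
  by_cases ht : Nontrivial (W t)
  swap
  · haveI : Subsingleton (W t) := not_nontrivial_iff_subsingleton.1 ht
    exact Subsingleton.elim _ _
  -- two non-zero summands: irreducible (in Mathlib's sense) …
  have hirr' : ∀ u, Nontrivial (W u) → (σ u).IsIrreducible := fun u hu => by
    haveI := hu
    haveI : Nontrivial (Subrepresentation (σ u)) := by
      refine ⟨⟨⊥, ⊤, fun hbt => ?_⟩⟩
      have h' : ((⊥ : Subrepresentation (σ u)) : Set (W u)) = ((⊤ : Subrepresentation (σ u)) : Set (W u)) := by rw [hbt]
      obtain ⟨x, hx⟩ := exists_ne (0 : W u)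
      have hxtop : x ∈ ((⊤ : Subrepresentation (σ u)) : Set (W u)) := (Submodule.mem_top : x ∈ (⊤ : Submodule ℂ (W u)))
      rw [← h'] at hxtop
      exact hx ((Submodule.mem_bot ℂ).1 hxtop)
    exact ⟨hirr u⟩
  haveI := hirr' s hs
  haveI := hirr' t ht
  -- … and (by `hsep`) non-isomorphic
  have hne : IsEmpty ((σ s).Equiv (σ t)) := ⟨fun e => hst (hsep s t hs ⟨e.toLinearEquiv, fun g v => by
    have := LinearMap.congr_fun (e.isIntertwining' g) v
    simpa using this⟩)⟩
  exact Literature.NumberTheory.Automorphic.eq_zero_of_heckeEquivariant_of_isEmpty_equiv (σ s) (σ t) K.1.1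
    (finite_orbit_level K) hne φ hφK hφ w hw


end Sec42Data.BettiPinning

end Literature.NumberTheory.Automorphic.Liu2021.AppendixC

end
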